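import Summits.BirchSwinnertonDyer.Rank1Residual.X11b.BDPRouteOpenInputFieldGiven
import HarnessLib

/-!
# Class X11b, route p2: the semistable end state and the end-state class record OVER ONE FIELD PER
# PAIR, AT THE GIVEN FIELD — without Hoffstein–Luo (cell `b2b-bsdres`, sub-cell `multr1-p2`, gen 28;
# file 2)

HONEST FRAMING (cell `b2b-bsdres`, run/shared/lean/b2b/bsd-rank1-residual/, verbatim in every
file): the goal of the cell is to DELETE the COMBINATION-SHAPED residual classes of the
Birch–Swinnerton-Dyer formula for ALL analytic-rank `≤ 1` elliptic curves over `ℚ` — "full BSD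
formula for every rank `≤ 1` curve in class `C`" assembled STRICTLY from published theorems — so
that the rank-`≤ 1` remainder becomes exactly the CONSTRUCTION-SHAPED classes, which are TYPED
(missing-input `Prop`s), NOT attempted. This is not "finishing BSD". Sub-cell `multr1-p2` is a
RESEARCH ROUTE on class X11b (`ClassX11b W p := r_an = 1 ∧ p ≠ 2 ∧ mult(p) ∧ irr(p)`); no claim
beyond the stated class and loci; X11b's label does not change; NOTHING is booked by this file.

THEOREMS ONLY (no definition, no named fact, no `sorry`).

## What this file proves

File 1 (`BDPRouteOpenInputFieldGiven`) reads the Euler-system half on the Locus AT THE GIVEN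
admissible field (Kolyvagin 1990 Thm. A over that field; no Hoffstein–Luo). This file re-derives the
two gen-27 records that are handed a field, WITHOUT the binder `hHL`:

* `P2.bsdp_of_semistable_of_imcDivSomeFrameAtGivenField` — THE SEMISTABLE END STATE OVER ONE FIELD
  (twin of `P2.bsdp_of_semistable_of_imcDivSomeFrameAtField`): every semistable X11b pair at
  `p ≥ 5` ⇐ PUB (route p2's + lever's + `h32`) + cited PT/EP + (2.4)∃♭ over ONE admissible `K₀`
  + [NOTHING on the Locus ∣ REG or TC off it].
* `P2.bsdp_of_onTree_endStateAtGivenField` — THE END-STATE CLASS RECORD OVER ONE FIELD PER PAIR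
  (twin of `P2.bsdp_of_onTree_endStateAtField`): X11b `p ≥ 5` ⇐ PUB + cited + per surjective pair
  ONE admissible `K` with (2.4)∃♭ over `K` (+ value∃♭ over `K` off the semistable pairs) + REG only
  where `p ∣ ∏c` + TC on ¬(ram) ∧ `p ∤ ∏c` + conjecture (334) + corner (64); on a Locus pair the
  handed-in `K` serves BOTH halves.

Hoffstein–Luo 1997 is thereby confined to the `…_prescribedFields` SUPPLIERS of gen 27 (which hand
a Hoffstein–Luo field to these records). CONDITIONAL on the typed inputs exactly as in gen 27;
nothing booked; labels UNCHANGED; X11b stays CONSTRUCTION-SHAPED.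

## References

* [McCallumLMS1991] §1 Theorem (Kolyvagin), p. 296. * [Skinner2016PacificMC] Thm. C (§1).
* [Castella2018] Thms. 2.3, 3.1, 3.2, §5. * [Castella2018Erratum] (2.4). * [Mazur1978] Cor. 4.1.
* [Disegni2020] Thm. 1, (∗). * [Wuthrich2014] Thm. 3, Prop. 21. * [SteinWuthrich2013] Thm. 6.1.
* [BalakrishnanEtAl2019] Thm. 1.2. * [Miller2011LMS] Def. 1.1.
-/

noncomputable section

open scoped Classical NumberField

open WeierstrassCurve NumberField IsDedekindDomain Field
open Literature.NumberTheory.EllipticCurves Literature.NumberTheory.EllipticCurves.GreenbergSelmer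
  Literature.NumberTheory.EllipticCurves.ModularForms
  Literature.NumberTheory.EllipticCurves.Rank1Residual
  Literature.NumberTheory.EllipticCurves.Rank1Residual.Typed
  Literature.NumberTheory.EllipticCurves.Wuthrich2014
  Literature.NumberTheory.EllipticCurves.Castella2018
  Literature.NumberTheory.EllipticCurves.SteinWuthrich2013
  Literature.NumberTheory.EllipticCurves.Disegni2020
  Literature.NumberTheory.EllipticCurves.Skinner2016
  Literature.NumberTheory.EllipticCurves.BalakrishnanEtAl2019
  Literature.NumberTheory.EllipticCurves.KrizLi2019
  Literature.NumberTheory.QuadraticFields.Quadratic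
  Literature.NumberTheory.Automorphic
  Literature.NumberTheory.GaloisRepresentations Literature.NumberTheory.GaloisCohomology

namespace Summit.BirchSwinnertonDyer.Rank1Residual.X11b

/-! ### §1 The semistable end state over one field, without Hoffstein–Luo -/

section Records

variable (W : WeierstrassCurve ℚ) [W.IsElliptic] [W.IsGloballyMinimal] (p : ℕ) [Fact p.Prime]

/-- **SEMISTABLE END STATE OVER ONE FIELD — `hHL`-free.** Every semistable X11b pair at `p ≥ 5`:
`BSD(E,p)` from route p2's and the lever's published named facts, `h32`, the cited `hPT`/`hEP`,
THE open statement (2.4)∃♭ over ONE admissible field `K₀`, and — OFF the Locus only — one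
certificate (REG, or TC when `p ∤ ∏c`). On the Locus BOTH halves are read at `K₀` (file 1). Gen 27's
`P2.bsdp_of_semistable_of_imcDivSomeFrameAtField` minus the binder `hHL`. CONDITIONAL on (2.4)∃♭
over `K₀` (OPEN) and the certificate; nothing booked.
[cite: Castella2018Erratum, (2.4), Thm. 1.1 (pp. 1, 4)] [cite: Castella2018, Thms. 2.3, 3.1, 3.2, §5]
[cite: Skinner2016PacificMC, Thm. C (§1)] [cite: McCallumLMS1991, §1 Theorem (Kolyvagin), p. 296]
[cite: Disegni2020, Thm. 1 (§1.2), (∗)] [cite: Wuthrich2014, Thm. 3 (p. 383), Prop. 21 (p. 400)]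
[cite: SteinWuthrich2013, Thm. 6.1, §4.2] [cite: Miller2011LMS, Def. 1.1] -/
theorem P2.bsdp_of_semistable_of_imcDivSomeFrameAtGivenField
    -- route p2's published inputs
    (hGZ : ∀ (N : ℕ) [NeZero N] (W : WeierstrassCurve ℚ) (K : Type) [Field K] [NumberField K],
      gross_zagier N W K)
    (hKo : ∀ (N : ℕ) [NeZero N] (W : WeierstrassCurve ℚ) (K : Type) [Field K] [NumberField K],
      kolyvagin N W K)
    (hB : ∀ (N : ℕ) [NeZero N] (W : WeierstrassCurve ℚ) (K : Type) [Field K] [NumberField K],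
      Kolyvagin1990_padicValNat_card_sha_le N W K)
    (hSk : Skinner2016.thmC_padicValRat_bsd_rank_zero) (hWu : sha_dvd_analyticSha)
    (hGZK : rank_eq_analyticRank_of_analyticRank_le_one) (hnf : exists_isNewformOf)
    (hMaz : mazur_not_dvd_maninConstant_of_odd)
    (hPT : ∀ (K : Type) [Field K] [NumberField K], poitouTate_sum_localTatePairing_eq_zero K)
    (hEP : ∀ (K : Type) [Field K] [NumberField K] (v : HeightOneSpectrum (𝓞 K)),
      localEulerPoincareCharacteristic (v.adicCompletion K))
    -- Castella 2018 Thms. 3.1–3.2 (PUBLISHED; semistable scope)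
    (h32 : thm32_exists_isBDPLFunction_valueAtOne)
    -- the lever's published inputs
    (hK : kato_charIdeal_dvd_multiplicative_of_surjective)
    (hJn : thm61_nonsplitMultiplicative) (hJs : thm61_splitMultiplicative)
    (hHn : exists_isMultCanonical) (hHs : exists_isSplitMultCanonical)
    (hD : thm1_padicBSD_rankOne_multiplicative) (hpar : nonempty_modularParametrizationData)
    -- the pair: semistable X11b, `p ≥ 5`
    (hss : Semistable W) (hX : ClassX11b W p) (hp5 : 5 ≤ p)
    -- ONE admissible field and THE open statement over it
    {K₀ : Type} [Field K₀] [NumberField K₀]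
    (hK₀ : IsImaginaryQuadratic K₀) (hodd : Odd (NumberField.discr K₀))
    (hpd : ¬ (p : ℤ) ∣ NumberField.discr K₀) (hμ : ¬ p ∣ Units.torsionOrder K₀)
    (hHN₀ : SatisfiesHeegnerHypothesis (W.conductorNorm ℤ) K₀)
    (hLt₀ : (W.quadraticTwist (NumberField.discr K₀ : ℚ)).entireLFunction 1 ≠ 0)
    (hDiv : P2.IMCDivSomeFrameOnTreeAtField W p K₀)
    -- OFF the Locus: ONE certificate — the `p`-adic height, or (`p ∤ ∏c`) a twist certificate
    (hcert : ¬ (Ram W p ∧ ¬ p ∣ W.tamagawaProduct) →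
      ClassClosure.RegulatorNonvanishingAt W p ∨
      (¬ p ∣ W.tamagawaProduct ∧
        ∃ (K : Type) (_ : Field K) (_ : NumberField K) (Wd : WeierstrassCurve ℚ) (_ : Wd.IsElliptic)
          (_ : Wd.IsGloballyMinimal) (Cd : VariableChange ℚ) (qd : ℚ),
          IsImaginaryQuadratic K ∧ SatisfiesHeegnerHypothesis (W.conductorNorm ℤ) K ∧
          NumberField.discr K < -4 ∧ Cd • W.quadraticTwist (NumberField.discr K : ℚ) = Wd ∧
          Wd.entireLFunction 1 / (Wd.realPeriodRat : ℂ) = (qd : ℂ) ∧ qd ≠ 0 ∧ padicValRat p qd = 0)) :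
    BSDp W p := by
  have hmod : hasEntireLFunction_rat := hasEntireLFunction_rat_of_exists_isNewformOf hnf
  have hsurj : Surj W p := surj_of_irr_of_semistable W p hX.2.2.2 hss
  -- the main-conjecture half from (2.4)∃♭ over `K₀` (value from `h32`)
  have hlow : Typed.MissingLowerBoundAt W p :=
    P2.missingLowerBoundAt_of_openInputAtField W p hGZ hKo hWu hGZK hmod hnf hMaz hPT hEP hK₀ hodd hpd
      hμ hHN₀ hLt₀
      (P2.openInputOnTreeAtField_of_someFrames hnf hGZK hKo hPT hEP hDiv
        (P2.bdpValueSomeFrameOnTreeAtField_of_thm32_of_semistable h32 hss))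
      hX hp5 hsurj
  -- the Euler-system half: at `K₀` on the Locus, one certificate off it
  have hup : Typed.MissingUpperBoundAt W p := by
    by_cases hloc : Ram W p ∧ ¬ p ∣ W.tamagawaProduct
    · exact missingUpperBoundAt_of_classX11b_of_ram_of_not_dvd_atGivenField W p hGZ hKo hB hSk hGZK
        hmod hnf hMaz hK₀ hodd hpd hμ hHN₀ hLt₀ hX hloc.1 hloc.2
    · rcases hcert hloc with hReg | ⟨htam, K, _, _, Wd, _, _, Cd, qd, hK', hHN, hdK, hWd, hqd, hqd0, hvd⟩
      · exact missingUpperBoundAt_of_katoSurj_of_regulatorNonvanishing W p hK hJn hJs hHn hHs hD hGZK hpar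
          hp5 hX.2.2.1 hX.1 hsurj (disegniStar_of_classX11b_of_semistable hnf hX hss) hReg
      · exact missingUpperBoundAt_of_classX11b_of_twistUnit W p hGZ hKo hB hGZK hmod hnf hMaz hX hp5 hsurj
          htam K hK' hHN hdK Wd Cd hWd qd hqd hqd0 hvd
  exact Typed.bsdp_of_missingPPartAt W p hGZK (by rw [hX.1])
    (Typed.missingPPartAt_of_lower_of_upper W p hlow hup)

end Records

/-! ### §2 The end-state class record over one field per pair, without Hoffstein–Luo -/

/-- **ROUTE p2 — THE END-STATE CLASS RECORD OVER ONE FIELD PER PAIR, `hHL`-free (gen 28).**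
`∀ (E, p) ∈` X11b, `p ≥ 5 → BSD(E, p)` from route p2's and the lever's published named facts
(+ Kolyvagin 1990 Thm. A, Skinner 2016 Thm. C, Cas18 Thms. 3.1–3.2 `h32`, BDMTV — and NOT
Hoffstein–Luo), the cited Poitou–Tate / local Euler characteristic, and the typed inputs exactly as
in gen 27's `P2.bsdp_of_onTree_endStateAtField`: (T1″) per surjective pair ONE admissible Heegner
field `K` with (2.4)∃♭ over `K` — THE open statement — and, only off the semistable pairs,
value∃♭ over `K` (PUB shape); NOTHING per pair on the Locus, where the handed-in `K` now serves
BOTH halves (file 1); (REG) only on the surjective pairs with `p ∣ ∏c`; (TC) on the ¬(ram) pairs with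
`p ∤ ∏c`; the conjecture on split-only ∧ `p ∣ ∏c`; the corner. CONDITIONAL; nothing booked; labels
UNCHANGED; X11b stays CONSTRUCTION-SHAPED.
[cite: Castella2018Erratum, (2.4) (p. 4)] [cite: Castella2018, Thms. 2.3, 3.1, 3.2, §5]
[cite: McCallumLMS1991, §1 Theorem (Kolyvagin), p. 296] [cite: Skinner2016PacificMC, Thm. C (§1)]
[cite: Disegni2020, Thm. 1 (§1.2), (∗)] [cite: Wuthrich2014, Thm. 3 (p. 383), Prop. 21 (p. 400)]
[cite: SteinWuthrich2013, Thm. 6.1, §4.2] [cite: BalakrishnanEtAl2019, Thm. 1.2] [cite: Miller2011LMS, Def. 1.1] -/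
theorem P2.bsdp_of_onTree_endStateAtGivenField
    -- route p2's published inputs
    (hGZ : ∀ (N : ℕ) [NeZero N] (W : WeierstrassCurve ℚ) (K : Type) [Field K] [NumberField K],
      gross_zagier N W K)
    (hKo : ∀ (N : ℕ) [NeZero N] (W : WeierstrassCurve ℚ) (K : Type) [Field K] [NumberField K],
      kolyvagin N W K)
    (hB : ∀ (N : ℕ) [NeZero N] (W : WeierstrassCurve ℚ) (K : Type) [Field K] [NumberField K],
      Kolyvagin1990_padicValNat_card_sha_le N W K)
    (hSk : Skinner2016.thmC_padicValRat_bsd_rank_zero) (hWu : sha_dvd_analyticSha)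
    (hGZK : rank_eq_analyticRank_of_analyticRank_le_one) (hnf : exists_isNewformOf)
    (hMaz : mazur_not_dvd_maninConstant_of_odd) (hBDMTV : thm12_not_le_normalizer_splitCartan)
    (hPT : ∀ (K : Type) [Field K] [NumberField K], poitouTate_sum_localTatePairing_eq_zero K)
    (hEP : ∀ (K : Type) [Field K] [NumberField K] (v : HeightOneSpectrum (𝓞 K)),
      localEulerPoincareCharacteristic (v.adicCompletion K))
    -- Castella 2018 Thms. 3.1–3.2 (PUBLISHED; semistable scope)
    (h32 : thm32_exists_isBDPLFunction_valueAtOne)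
    -- the lever's published inputs
    (hK : kato_charIdeal_dvd_multiplicative_of_surjective)
    (hJn : thm61_nonsplitMultiplicative) (hJs : thm61_splitMultiplicative)
    (hHn : exists_isMultCanonical) (hHs : exists_isSplitMultCanonical)
    (hD : thm1_padicBSD_rankOne_multiplicative) (hpar : nonempty_modularParametrizationData)
    -- (T1″) ONE admissible field per surjective pair, with (2.4)∃♭ over it (+ value off semistable)
    (hField : ∀ (W : WeierstrassCurve ℚ) [W.IsElliptic] [W.IsGloballyMinimal] (p : ℕ) [Fact p.Prime],
      ClassX11b W p → 5 ≤ p → Surj W p →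
      ∃ (K : Type) (_ : Field K) (_ : NumberField K), IsImaginaryQuadratic K ∧
        Odd (NumberField.discr K) ∧ ¬ (p : ℤ) ∣ NumberField.discr K ∧ ¬ p ∣ Units.torsionOrder K ∧
        SatisfiesHeegnerHypothesis (W.conductorNorm ℤ) K ∧
        (W.quadraticTwist (NumberField.discr K : ℚ)).entireLFunction 1 ≠ 0 ∧
        P2.IMCDivSomeFrameOnTreeAtField W p K ∧
        (¬ Semistable W → P2.BDPValueSomeFrameOnTreeAtField W p K))
    -- (REG) ONLY where `p ∣ ∏_ℓ c_ℓ(E)`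
    (hReg : ∀ (W : WeierstrassCurve ℚ) [W.IsElliptic] [W.IsGloballyMinimal] (p : ℕ) [Fact p.Prime],
      ClassX11b W p → 5 ≤ p → Surj W p → p ∣ W.tamagawaProduct →
      ClassClosure.RegulatorNonvanishingAt W p)
    -- (TC) ONE twist certificate per ¬(ram) ∧ surj pair with `p ∤ ∏c`
    (hTC : ∀ (W : WeierstrassCurve ℚ) [W.IsElliptic] [W.IsGloballyMinimal] (p : ℕ) [Fact p.Prime],
      ClassX11b W p → 5 ≤ p → Surj W p → ¬ Ram W p → ¬ p ∣ W.tamagawaProduct →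
      ∃ (K : Type) (_ : Field K) (_ : NumberField K) (Wd : WeierstrassCurve ℚ) (_ : Wd.IsElliptic)
        (_ : Wd.IsGloballyMinimal) (Cd : VariableChange ℚ) (qd : ℚ),
        IsImaginaryQuadratic K ∧ SatisfiesHeegnerHypothesis (W.conductorNorm ℤ) K ∧
        NumberField.discr K < -4 ∧ Cd • W.quadraticTwist (NumberField.discr K : ℚ) = Wd ∧
        Wd.entireLFunction 1 / (Wd.realPeriodRat : ℂ) = (qd : ℂ) ∧ qd ≠ 0 ∧ padicValRat p qd = 0)
    -- (T2∗′)
    (hC : ∀ (W : WeierstrassCurve ℚ) [W.IsElliptic] [W.IsGloballyMinimal] (p : ℕ) [Fact p.Prime],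
      ClassX11b W p → 5 ≤ p → W.HasSplitMultiplicativeReductionAtPrime p →
      (¬ ∃ (m : ℕ) (_ : Fact m.Prime), m ≠ p ∧ W.HasMultiplicativeReductionAtPrime m) →
      p ∣ W.tamagawaProduct → ClassClosure.RelativeExceptionalLeadingTermAt W p)
    -- (T4′)
    (hCorner : ∀ (W : WeierstrassCurve ℚ) [W.IsElliptic] [W.IsGloballyMinimal] (p : ℕ)
      [Fact p.Prime], ClassX11b W p → ¬ Surj W p → (p = 5 ∨ p = 7) →
        p ∣ padicValInt p W.minimalDiscriminantInt → ¬ Ram W p → Typed.MissingPPartAt W p)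
    (W : WeierstrassCurve ℚ) [W.IsElliptic] [W.IsGloballyMinimal] (p : ℕ) [Fact p.Prime]
    (hX : ClassX11b W p) (hp5 : 5 ≤ p) : BSDp W p := by
  have hmod : hasEntireLFunction_rat := hasEntireLFunction_rat_of_exists_isNewformOf hnf
  have hp2 : p ≠ 2 := hX.2.1
  by_cases hsurj : Surj W p
  · -- the handed-in field and the main-conjecture half over it
    obtain ⟨K, _, _, hK', hodd, hpd, hμ, hHN, hLt, hDiv, hVal⟩ := hField W p hX hp5 hsurj
    have hV : P2.BDPValueSomeFrameOnTreeAtField W p K := by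
      by_cases hss : Semistable W
      · exact P2.bdpValueSomeFrameOnTreeAtField_of_thm32_of_semistable h32 hss
      · exact hVal hss
    have hlow : Typed.MissingLowerBoundAt W p :=
      P2.missingLowerBoundAt_of_openInputAtField W p hGZ hKo hWu hGZK hmod hnf hMaz hPT hEP hK' hodd
        hpd hμ hHN hLt (P2.openInputOnTreeAtField_of_someFrames hnf hGZK hKo hPT hEP hDiv hV) hX hp5
        hsurj
    refine Typed.bsdp_of_missingPPartAt W p hGZK (by rw [hX.1])
      (Typed.missingPPartAt_of_lower_of_upper W p hlow ?_)
    -- the Euler-system half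
    by_cases htam : p ∣ W.tamagawaProduct
    · -- `p ∣ ∏c`: the cyclotomic lever with (REG)
      by_cases hst : W.HasSplitMultiplicativeReductionAtPrime p →
          ∃ (m : ℕ) (_ : Fact m.Prime), m ≠ p ∧ W.HasMultiplicativeReductionAtPrime m
      · exact missingUpperBoundAt_of_katoSurj_of_regulatorNonvanishing W p hK hJn hJs hHn hHs hD hGZK
          hpar hp5 hX.2.2.1 hX.1 hsurj hst (hReg W p hX hp5 hsurj htam)
      · rw [Classical.not_imp] at hst
        obtain ⟨hsplit, hm⟩ := hst
        exact missingUpperBoundAt_of_katoSurj_split_of_relativeLeadingTerm W p hK hJs hHs hGZK hpar hp2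
          hX.2.2.1 hsplit hX.1
          (kato_charIdeal_dvd_multiplicative_of_surjective.surjective_pow_of_five_le W p hp5 hsurj)
          (hC W p hX hp5 hsplit hm htam) (hReg W p hX hp5 hsurj htam).2
    · by_cases hram : Ram W p
      · -- the Locus: BOTH halves at the handed-in field (file 1) — no Hoffstein–Luo
        exact missingUpperBoundAt_of_classX11b_of_ram_of_not_dvd_atGivenField W p hGZ hKo hB hSk hGZK
          hmod hnf hMaz hK' hodd hpd hμ hHN hLt hX hram htam
      · -- ¬(ram) ∧ `p ∤ ∏c`: the twist certificate
        obtain ⟨K₁, _, _, Wd, _, _, Cd, qd, hK₁, hHN₁, hdK, hWd, hqd, hqd0, hvd⟩ :=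
          hTC W p hX hp5 hsurj hram htam
        exact missingUpperBoundAt_of_classX11b_of_twistUnit W p hGZ hKo hB hGZK hmod hnf hMaz hX hp5
          hsurj htam K₁ hK₁ hHN₁ hdK Wd Cd hWd qd hqd hqd0 hvd
  · -- the non-surjective corner, localised
    obtain ⟨h57, hdvd, hnram⟩ := ClassX11b.not_surj_shape W p hBDMTV hX hp5 hsurj
    exact Typed.bsdp_of_missingPPartAt W p hGZK (by rw [hX.1]) (hCorner W p hX hsurj h57 hdvd hnram)

end Summit.BirchSwinnertonDyer.Rank1Residual.X11b

end
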